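import Mathlib
import Summits.PneNP.PneNP.Theorems.ClusUniversalCertificateCubeA

/-!
# Route ClusUniversalCertificate — the hypercube certificate inequality, II: the core inequality and `L1Cert`

Helper file for `stmt-PneNP-19683` (route-PneNP-ClusUniversalCertificate, rung F-N1; cell pnp-ideate,
record HOME/pnp-ideate-lit/UniversalCertificate.lean, ROUND-5 §T). Part II: `core`
(`Σ_y dim W_y ≤ 2 Σ_y wt y` for any flats `y + W_y ⊆ Y`, by rank–nullity onto `supp y` plus the
layer-cake sum of Theorem D), the one-sided certificate codimension `codimIn`, the hypercube
certificate inequality `L1Cert N : ∀ Y ⊆ 𝔽₂^N, Σ_k |#{y_k = 0} − #{y_k = 1}| ≤ Σ_{y∈Y} codimIn Y y`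
and its proof `l1Cert_holds` (translate to a coordinatewise majority point). [folklore; ROUND-5 §T]
-/

set_option linter.dupNamespace false -- `Summit.PneNP.PneNP.…`: summit = sub-problem name (D-0017 single-conjunct layout)

namespace Summit.PneNP.PneNP.Theorems.ClusCube

open Classical Finset MvPolynomial

noncomputable section

variable {N : ℕ}

/-- coordinate projection onto `supp y` -/
def projSupp (y : V N) : V N →ₗ[ZMod 2] (supp y → ZMod 2) :=
  LinearMap.pi fun i : supp y => LinearMap.proj (i : Fin N)

/-- the upward part of `W` at `y`: vectors of `W` vanishing on `supp y` -/
def upPart (y : V N) (W : Submodule (ZMod 2) (V N)) : Submodule (ZMod 2) (V N) :=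
  W ⊓ LinearMap.ker (projSupp y)

/-- Membership in the upward part of a subspace at `y`. -/
lemma mem_upPart (y : V N) (W : Submodule (ZMod 2) (V N)) (v : V N) :
    v ∈ upPart y W ↔ v ∈ W ∧ ∀ i, y i ≠ 0 → v i = 0 := by
  unfold upPart
  rw [Submodule.mem_inf, LinearMap.mem_ker]
  have : projSupp y v = 0 ↔ ∀ i, y i ≠ 0 → v i = 0 := by
    constructor
    · intro h i hi
      have := congrFun h ⟨i, mem_supp.mpr hi⟩
      simpa [projSupp] using this
    · intro h
      funext i
      simpa [projSupp] using h i (mem_supp.mp i.2)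
  rw [this]

/-- rank–nullity: `dim W ≤ |y| + dim (upward part)` -/
lemma finrank_le_wt_add (y : V N) (W : Submodule (ZMod 2) (V N)) :
    Module.finrank (ZMod 2) W ≤ wt y + Module.finrank (ZMod 2) (upPart y W) := by
  let f : W →ₗ[ZMod 2] (supp y → ZMod 2) := (projSupp y).comp W.subtype
  have hrn := LinearMap.finrank_range_add_finrank_ker f
  have h1 : Module.finrank (ZMod 2) (LinearMap.range f) ≤ wt y := by
    refine (Submodule.finrank_le _).trans ?_
    rw [Module.finrank_pi, Fintype.card_coe, wt]
  have h2 : Module.finrank (ZMod 2) (LinearMap.ker f) = Module.finrank (ZMod 2) (upPart y W) := by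
    have : (LinearMap.ker f).map W.subtype = upPart y W := by
      rw [LinearMap.ker_comp, Submodule.map_comap_subtype]
      rfl
    rw [← this, Submodule.finrank_map_subtype_eq]
  omega

/-- A subspace of dimension `≥ θ` contains a subspace of dimension exactly `θ`. -/
lemma exists_submodule_finrank_eq (U : Submodule (ZMod 2) (V N)) (θ : ℕ)
    (h : θ ≤ Module.finrank (ZMod 2) U) :
    ∃ U' : Submodule (ZMod 2) (V N), U' ≤ U ∧ Module.finrank (ZMod 2) U' = θ := by
  let b := Module.finBasis (ZMod 2) U
  let v : Fin θ → V N := fun i => (b (Fin.castLE h i) : V N)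
  have hv : LinearIndependent (ZMod 2) v := by
    have h1 : LinearIndependent (ZMod 2) (fun i : Fin θ => b (Fin.castLE h i)) :=
      b.linearIndependent.comp _ (Fin.castLE_injective h)
    exact h1.map' U.subtype U.ker_subtype
  refine ⟨Submodule.span (ZMod 2) (Set.range v), ?_, ?_⟩
  · rw [Submodule.span_le]
    rintro _ ⟨i, rfl⟩
    exact (b _).2
  · rw [finrank_span_eq_card hv, Fintype.card_fin]

/-- layer-cake formula for a bounded `ℕ`-valued function -/
lemma sum_eq_sum_card_lt (Y : Finset (V N)) (f : V N → ℕ) (hf : ∀ y ∈ Y, f y ≤ N) :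
    ∑ y ∈ Y, f y = ∑ θ ∈ range N, (Y.filter fun y => θ < f y).card := by
  simp_rw [card_filter]
  rw [sum_comm]
  refine sum_congr rfl fun y hy => ?_
  rw [← Finset.card_filter (fun θ => θ < f y) (range N)]
  have : (range N).filter (fun θ => θ < f y) = range (f y) := by
    ext θ
    simp only [mem_filter, mem_range]
    constructor
    · exact fun h => h.2
    · exact fun h => ⟨lt_of_lt_of_le h (hf y hy), h⟩
  rw [this, card_range]

/-- **Core theorem.**  If every `y ∈ Y` carries a flat `y + W y ⊆ Y`, then
`Σ_y dim (W y) ≤ 2 Σ_y wt y`. -/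
theorem core (Y : Finset (V N)) (W : V N → Submodule (ZMod 2) (V N))
    (hW : ∀ y ∈ Y, ∀ w ∈ W y, y + w ∈ Y) :
    ∑ y ∈ Y, Module.finrank (ZMod 2) (W y) ≤ 2 * ∑ y ∈ Y, wt y := by
  -- level-wise domination for the upward parts
  have hdom : ∀ θ, (Y.filter fun y => θ < Module.finrank (ZMod 2) (upPart y (W y))).card
      ≤ (Y.filter fun t => θ < wt t).card := by
    intro θ
    set A := Y.filter fun y => θ < Module.finrank (ZMod 2) (upPart y (W y)) with hA
    have hex : ∀ a : V N, ∃ U' : Submodule (ZMod 2) (V N),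
        a ∈ A → (U' ≤ upPart a (W a) ∧ Module.finrank (ZMod 2) U' = θ + 1) := by
      intro a
      by_cases ha : a ∈ A
      · obtain ⟨U', h1, h2⟩ :=
          exists_submodule_finrank_eq (upPart a (W a)) (θ + 1) (mem_filter.mp ha).2
        exact ⟨U', fun _ => ⟨h1, h2⟩⟩
      · exact ⟨⊥, fun h => absurd h ha⟩
    choose Va hVa using hex
    have key := card_rich_le_card_heavy Y A (θ + 1) Va ?_ ?_ ?_
    · have heq : (Y.filter fun t => θ + 1 ≤ wt t) = Y.filter fun t => θ < wt t := by
        ext t; simp only [mem_filter, Nat.succ_le_iff]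
      rw [heq] at key
      exact key
    · intro a ha v hv i hi
      exact ((mem_upPart _ _ _).mp ((hVa a ha).1 hv)).2 i hi
    · intro a ha
      exact (hVa a ha).2
    · intro a ha v hv
      exact hW a (mem_filter.mp ha).1 v ((mem_upPart _ _ _).mp ((hVa a ha).1 hv)).1
  have hup : ∑ y ∈ Y, Module.finrank (ZMod 2) (upPart y (W y)) ≤ ∑ y ∈ Y, wt y := by
    rw [sum_eq_sum_card_lt Y (fun y => Module.finrank (ZMod 2) (upPart y (W y)))
        (fun y _ => (Submodule.finrank_le _).trans (by simp)),
      sum_eq_sum_card_lt Y wt (fun y _ => wt_le y)]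
    exact sum_le_sum fun θ _ => hdom θ
  calc ∑ y ∈ Y, Module.finrank (ZMod 2) (W y)
      ≤ ∑ y ∈ Y, (wt y + Module.finrank (ZMod 2) (upPart y (W y))) :=
        sum_le_sum fun y _ => finrank_le_wt_add y (W y)
    _ = ∑ y ∈ Y, wt y + ∑ y ∈ Y, Module.finrank (ZMod 2) (upPart y (W y)) := sum_add_distrib
    _ ≤ ∑ y ∈ Y, wt y + ∑ y ∈ Y, wt y := by omega
    _ = 2 * ∑ y ∈ Y, wt y := by ring

/-! ## The universal certificate inequality `L1Cert N` (p1's statement, verbatim) -/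

/-- Least codimension of an affine subspace through `y` contained in `Y` (p1, Sketch-KL.lean). -/
def codimIn {N : ℕ} (Y : Finset (V N)) (y : V N) : ℕ :=
  sInf {c | ∃ A : AffineSubspace (ZMod 2) (V N),
    y ∈ A ∧ (∀ z ∈ A, z ∈ Y) ∧ N ≤ Module.finrank (ZMod 2) A.direction + c}

/-- R★★ (coordinate form), p1's `L1Cert` verbatim. -/
def L1Cert (N : ℕ) : Prop :=
  ∀ Y : Finset (V N),
    ∑ k : Fin N, |∑ y ∈ Y, (if y k = 0 then (1 : ℤ) else -1)| ≤ ∑ y ∈ Y, (codimIn Y y : ℤ)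

/-- Every point of `Y` carries a flat inside `Y` realising its certificate codimension. -/
lemma exists_flat (Y : Finset (V N)) (y : V N) (hy : y ∈ Y) :
    ∃ W : Submodule (ZMod 2) (V N),
      (∀ w ∈ W, y + w ∈ Y) ∧ N ≤ Module.finrank (ZMod 2) W + codimIn Y y := by
  have hne : {c | ∃ A : AffineSubspace (ZMod 2) (V N),
      y ∈ A ∧ (∀ z ∈ A, z ∈ Y) ∧ N ≤ Module.finrank (ZMod 2) A.direction + c}.Nonempty := by
    refine ⟨N, AffineSubspace.mk' y ⊥, AffineSubspace.self_mem_mk' _ _, ?_, by simp⟩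
    intro z hz
    rw [AffineSubspace.mem_mk'] at hz
    have : z = y := by
      rw [Submodule.mem_bot, vsub_eq_sub, sub_eq_zero] at hz
      exact hz
    rw [this]
    exact hy
  obtain ⟨A, hyA, hAY, hdimA⟩ := Nat.sInf_mem hne
  refine ⟨A.direction, fun w hw => ?_, hdimA⟩
  have := AffineSubspace.vadd_mem_of_mem_direction hw hyA
  rw [vadd_eq_add, add_comm] at this
  exact hAY _ this

/-- **Theorem (R★★).**  The hypercube universal certificate inequality. -/
theorem l1Cert_holds (N : ℕ) : L1Cert N := by
  intro Y
  -- the flats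
  have hex : ∀ y : V N, ∃ W : Submodule (ZMod 2) (V N),
      y ∈ Y → ((∀ w ∈ W, y + w ∈ Y) ∧ N ≤ Module.finrank (ZMod 2) W + codimIn Y y) := by
    intro y
    by_cases hy : y ∈ Y
    · obtain ⟨W, h1, h2⟩ := exists_flat Y y hy
      exact ⟨W, fun _ => ⟨h1, h2⟩⟩
    · exact ⟨⊥, fun h => absurd h hy⟩
  choose W hW using hex
  -- a coordinatewise majority point
  let z : V N := fun k =>
    if (Y.filter fun y => y k ≠ 0).card ≤ (Y.filter fun y => y k = 0).card then 0 else 1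
  -- translate
  let τ : V N → V N := fun y => y - z
  have hτ : Function.Injective τ := fun a b h => sub_left_injective h
  set Y' := Y.image τ with hY'
  have hcore := core Y' (fun y' => W (y' + z)) ?_
  swap
  · intro y' hy' w hw
    rw [hY', mem_image] at hy' ⊢
    obtain ⟨y, hy, rfl⟩ := hy'
    have hyz : τ y + z = y := sub_add_cancel y z
    rw [hyz] at hw
    refine ⟨y + w, (hW y hy).1 w hw, ?_⟩
    simp only [τ]
    abel
  rw [hY', sum_image (fun a _ b _ h => hτ h), sum_image (fun a _ b _ h => hτ h)] at hcore
  have hsum_eq : ∀ x : V N, Module.finrank (ZMod 2) (W (τ x + z)) = Module.finrank (ZMod 2) (W x) :=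
    fun x => congrArg (fun t => Module.finrank (ZMod 2) (W t)) (sub_add_cancel x z)
  simp only [hsum_eq] at hcore
  -- hcore : Σ_y finrank (W y) ≤ 2 Σ_y wt (y - z)
  -- the left-hand side, coordinate by coordinate
  have hk : ∀ k : Fin N, |∑ y ∈ Y, (if y k = 0 then (1 : ℤ) else -1)|
      = (Y.card : ℤ) - 2 * ((Y.filter fun y => (y - z) k ≠ 0).card : ℤ) := by
    intro k
    have hsum : (∑ y ∈ Y, (if y k = 0 then (1 : ℤ) else -1))
        = ((Y.filter fun y => y k = 0).card : ℤ) - ((Y.filter fun y => y k ≠ 0).card : ℤ) := by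
      rw [Finset.sum_ite, sum_const, sum_const]
      simp
      ring
    have htot : (Y.filter fun y => y k = 0).card + (Y.filter fun y => y k ≠ 0).card = Y.card :=
      Finset.card_filter_add_card_filter_not _
    rw [hsum]
    by_cases h : (Y.filter fun y => y k ≠ 0).card ≤ (Y.filter fun y => y k = 0).card
    · have hz : z k = 0 := by simp only [z]; rw [if_pos h]
      have hcount : (Y.filter fun y => (y - z) k ≠ 0) = Y.filter fun y => y k ≠ 0 := by
        ext y; simp [hz]
      rw [hcount, abs_of_nonneg] <;> omega
    · have hz : z k = 1 := by simp only [z]; rw [if_neg h]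
      have hcount : (Y.filter fun y => (y - z) k ≠ 0) = Y.filter fun y => y k = 0 := by
        ext y
        simp only [mem_filter, Pi.sub_apply, hz]
        rcases (by decide : ∀ z : ZMod 2, z = 0 ∨ z = 1) (y k) with h' | h' <;> simp [h']
      rw [hcount, abs_of_nonpos] <;> omega
  -- sum over coordinates
  have hwt : (∑ k : Fin N, ((Y.filter fun y => (y - z) k ≠ 0).card : ℤ))
      = ∑ y ∈ Y, (wt (y - z) : ℤ) := by
    simp_rw [card_filter]
    push_cast
    rw [sum_comm]
    refine sum_congr rfl fun y _ => ?_
    rw [wt, supp, card_filter]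
    push_cast
    rfl
  have hL : (∑ k : Fin N, |∑ y ∈ Y, (if y k = 0 then (1 : ℤ) else -1)|)
      = (N : ℤ) * Y.card - 2 * ∑ y ∈ Y, (wt (y - z) : ℤ) := by
    simp_rw [hk]
    rw [sum_sub_distrib, sum_const, card_univ, Fintype.card_fin, ← mul_sum, hwt]
    simp
  rw [hL]
  -- the right-hand side
  have hR : (N : ℤ) * Y.card - ∑ y ∈ Y, (Module.finrank (ZMod 2) (W y) : ℤ)
      ≤ ∑ y ∈ Y, (codimIn Y y : ℤ) := by
    have : ∀ y ∈ Y, (N : ℤ) - (Module.finrank (ZMod 2) (W y) : ℤ) ≤ (codimIn Y y : ℤ) := by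
      intro y hy
      have := (hW y hy).2
      omega
    calc (N : ℤ) * Y.card - ∑ y ∈ Y, (Module.finrank (ZMod 2) (W y) : ℤ)
        = ∑ y ∈ Y, ((N : ℤ) - (Module.finrank (ZMod 2) (W y) : ℤ)) := by
          rw [sum_sub_distrib, sum_const]; simp [mul_comm]
      _ ≤ ∑ y ∈ Y, (codimIn Y y : ℤ) := sum_le_sum this
  have hc : (∑ y ∈ Y, (Module.finrank (ZMod 2) (W y) : ℤ)) ≤ 2 * ∑ y ∈ Y, (wt (y - z) : ℤ) := by
    exact_mod_cast hcore
  linarith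

end

end Summit.PneNP.PneNP.Theorems.ClusCube
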